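import Summits.AtomisticToContinuum.HydrodynamicLimit.Theorems.OneSphereInfluenceHardCorePoincareDobrushinSpectral

/-!
# OneSphereInfluenceHardCorePoincareDobrushinIdent — Abstract Dobrushin theory IV: identification
`P_i f = μ[f | z_{−i}]` and the kernel `[I₂] → [K]`

This file is part 7/9 of the DobrushinDoor chain proving the crux
`OneSphereInfluence.HardCorePoincare` (stmt-AtomisticToContinuum-13619) sorry-free; the closing
theorem `hardCorePoincare_holds` and the full account are in
`OneSphereInfluenceHardCorePoincareDobrushin.lean` (part 9/9). decomp-a2c · lens-1 · g39.

CONTENTS. Model-free. `siteOp_ae_eq_condExp` (locality + invariance ⇒ `P_i f` is a version of the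
conditional expectation given the other coordinates), `∫ (f − P_i f)² = ∫ condVar`, the bounded
Dobrushin–Glauber inequality in `condVar` form, the extension statement [I₂] `BoundedToL2Extension`
and `dobrushinGlauberPoincare_of_extension : [I₂] → [K]`.
-/

open MeasureTheory ProbabilityTheory Set Function
open scoped ENNReal

noncomputable section

namespace Summit.AtomisticToContinuum.HydrodynamicLimit.Theorems.HardCorePoincareDobrushin.Abstract

variable {n : ℕ} {E : Type} [MeasurableSpace E]
variable {K : Fin (n + 1) → Kernel (Fin (n + 1) → E) E} [∀ i, IsMarkovKernel (K i)]

/-! ### Identification: under locality + invariance, `P_i f` is a version of `μ[f | z_{−i}]` -/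

section Ident

variable {μ : Measure (Fin (n + 1) → E)} [IsProbabilityMeasure μ]

/-- The σ-algebra generated by the coordinates `≠ i` (as in the node's statement of `[K]`). -/
abbrev coordSigma (n : ℕ) (E : Type) [MeasurableSpace E] (i : Fin (n + 1)) :
    MeasurableSpace (Fin (n + 1) → E) :=
  MeasurableSpace.comap (fun (z : Fin (n + 1) → E) (j : Fin n) => z (i.succAbove j))
    MeasurableSpace.pi

/-- Dropping coordinate `i` is a measurable map `(Fin (n+1) → E) → (Fin n → E)`. -/
theorem measurable_dropCoord (i : Fin (n + 1)) :
    Measurable (fun (z : Fin (n + 1) → E) (j : Fin n) => z (i.succAbove j)) :=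
  measurable_pi_lambda _ fun _ => measurable_pi_apply _

/-- The σ-algebra generated by the coordinates other than `i` is contained in the product σ-algebra. -/
theorem coordSigma_le (i : Fin (n + 1)) :
    coordSigma n E i ≤ (MeasurableSpace.pi : MeasurableSpace (Fin (n + 1) → E)) :=
  (measurable_dropCoord i).comap_le

/-- If the configuration space `Fin (n+1) → E` carries a probability measure then `E` is nonempty. -/
theorem nonempty_of_isProbabilityMeasure (μ : Measure (Fin (n + 1) → E))
    [IsProbabilityMeasure μ] : Nonempty E := by
  rcases isEmpty_or_nonempty E with hE | hE
  · exfalso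
    haveI : IsEmpty (Fin (n + 1) → E) := ⟨fun z => hE.false (z 0)⟩
    have h := measure_univ (μ := μ)
    rw [Set.univ_eq_empty_iff.2 ‹_›, measure_empty] at h
    exact zero_ne_one h
  · exact hE

/-- An `i`-local measurable function is measurable for the σ-algebra of the other coordinates. -/
theorem measurable_coordSigma_of_local [Nonempty E] {g : (Fin (n + 1) → E) → ℝ}
    (hg : Measurable g) {i : Fin (n + 1)} (hgl : ∀ z y, g (update z i y) = g z) :
    Measurable[coordSigma n E i] g := by
  obtain y₀ := Classical.arbitrary E
  have hins : Measurable (fun w : Fin n → E => Fin.insertNth (α := fun _ => E) i y₀ w) :=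
    measurable_pi_iff.2 <| i.forall_iff_succAbove.2
      ⟨by simp, fun j => by simpa using measurable_pi_apply j⟩
  have hfac : g = (fun w : Fin n → E => g (Fin.insertNth (α := fun _ => E) i y₀ w)) ∘
      (fun (z : Fin (n + 1) → E) (j : Fin n) => z (i.succAbove j)) := by
    funext z
    simp only [Function.comp_apply]
    have h1 : Fin.insertNth (α := fun _ => E) i y₀ (fun j => z (i.succAbove j)) = update z i y₀ :=
      Fin.insertNth_removeNth i y₀ z
    rw [h1, hgl]
  rw [hfac]
  exact (hg.comp hins).comp (Measurable.of_comap_le le_rfl)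

/-- **Identification.** Under locality and invariance, `P_i f = μ[f | z_{−i}]` almost surely. -/
theorem siteOp_ae_eq_condExp
    (hloc : ∀ i (z : Fin (n + 1) → E) (y : E), K i (update z i y) = K i z)
    (hinv : ∀ i (F : (Fin (n + 1) → E) → ℝ≥0∞), Measurable F →
      ∫⁻ z, ∫⁻ y, F (update z i y) ∂(K i z) ∂μ = ∫⁻ z, F z ∂μ)
    {f : (Fin (n + 1) → E) → ℝ} (hf : Measurable f) {M : ℝ} (hfM : ∀ z, |f z| ≤ M)
    (i : Fin (n + 1)) :
    siteOp K i f =ᵐ[μ] μ[f | coordSigma n E i] := by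
  haveI := nonempty_of_isProbabilityMeasure μ
  have hm := coordSigma_le (n := n) (E := E) i
  refine ae_eq_condExp_of_forall_setIntegral_eq hm (integrable_of_bounded hf hfM)
    (fun s _ _ => (integrable_of_bounded (measurable_siteOp K hf i)
      (abs_siteOp_le K hfM i)).integrableOn) ?_ ?_
  · intro s hs _
    obtain ⟨s', hs', rfl⟩ := MeasurableSpace.measurableSet_comap.1 hs
    have hsm : MeasurableSet ((fun (z : Fin (n + 1) → E) (j : Fin n) => z (i.succAbove j)) ⁻¹' s') :=
      measurable_dropCoord i hs'
    set S := (fun (z : Fin (n + 1) → E) (j : Fin n) => z (i.succAbove j)) ⁻¹' s' with hS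
    set u : (Fin (n + 1) → E) → ℝ := S.indicator (fun _ => (1 : ℝ)) with hu
    have hum : Measurable u := measurable_const.indicator hsm
    have huM : ∀ z, |u z| ≤ 1 := by
      intro z
      rw [hu]
      by_cases hz : z ∈ S
      · rw [Set.indicator_of_mem hz]; simp
      · rw [Set.indicator_of_notMem hz]; simp
    have hmem : ∀ (z : Fin (n + 1) → E) (y : E), update z i y ∈ S ↔ z ∈ S := by
      intro z y
      rw [hS, Set.mem_preimage, Set.mem_preimage]
      have : (fun j : Fin n => update z i y (i.succAbove j)) = fun j => z (i.succAbove j) :=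
        funext fun j => update_of_ne (Fin.succAbove_ne i j) _ _
      rw [this]
    have hul : ∀ (z : Fin (n + 1) → E) (y : E), u (update z i y) = u z := by
      intro z y
      rw [hu]
      by_cases hz : z ∈ S
      · rw [Set.indicator_of_mem hz, Set.indicator_of_mem ((hmem z y).2 hz)]
      · rw [Set.indicator_of_notMem hz, Set.indicator_of_notMem (fun h => hz ((hmem z y).1 h))]
    have hPu : ∀ z, siteOp K i u z = u z := by
      intro z
      unfold siteOp
      simp_rw [hul]
      rw [integral_const, probReal_univ, one_smul]
    have e1 : S.indicator (siteOp K i f) = fun z => u z * siteOp K i f z := by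
      funext z
      rw [hu]
      by_cases hz : z ∈ S
      · rw [Set.indicator_of_mem hz, Set.indicator_of_mem hz, one_mul]
      · rw [Set.indicator_of_notMem hz, Set.indicator_of_notMem hz, zero_mul]
    have e2 : S.indicator f = fun z => u z * f z := by
      funext z
      rw [hu]
      by_cases hz : z ∈ S
      · rw [Set.indicator_of_mem hz, Set.indicator_of_mem hz, one_mul]
      · rw [Set.indicator_of_notMem hz, Set.indicator_of_notMem hz, zero_mul]
    rw [← integral_indicator hsm, ← integral_indicator hsm, e1, e2,
      integral_mul_siteOp_comm hloc hinv hum hf huM hfM i]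
    simp_rw [hPu]
  · exact (measurable_coordSigma_of_local (measurable_siteOp K hf i)
      (fun z y => siteOp_update hloc i f z y)).stronglyMeasurable.aestronglyMeasurable

/-- `∫ (f − P_i f)² dμ = ∫ Var[f | z_{−i}] dμ` for bounded measurable `f`. -/
theorem integral_sq_sub_siteOp_eq_integral_condVar
    (hloc : ∀ i (z : Fin (n + 1) → E) (y : E), K i (update z i y) = K i z)
    (hinv : ∀ i (F : (Fin (n + 1) → E) → ℝ≥0∞), Measurable F →
      ∫⁻ z, ∫⁻ y, F (update z i y) ∂(K i z) ∂μ = ∫⁻ z, F z ∂μ)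
    {f : (Fin (n + 1) → E) → ℝ} (hf : Measurable f) {M : ℝ} (hfM : ∀ z, |f z| ≤ M)
    (i : Fin (n + 1)) :
    ∫ z, (f z - siteOp K i f z) ^ 2 ∂μ = ∫ z, condVar (coordSigma n E i) f μ z ∂μ := by
  have hm := coordSigma_le (n := n) (E := E) i
  have hae := siteOp_ae_eq_condExp hloc hinv hf hfM i (μ := μ)
  have hsq : (fun z => (f z - siteOp K i f z) ^ 2) =ᵐ[μ]
      fun z => (f z - (μ[f | coordSigma n E i]) z) ^ 2 := by
    filter_upwards [hae] with z hz
    rw [hz]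
  have hI : Integrable (fun z => (f z - siteOp K i f z) ^ 2) μ := by
    have h1 : Measurable fun z => f z - siteOp K i f z := hf.sub (measurable_siteOp K hf i)
    have h2 : ∀ z, |f z - siteOp K i f z| ≤ M + M := fun z =>
      (abs_sub _ _).trans (add_le_add (hfM z) (abs_siteOp_le K hfM i z))
    have := integrable_mul_of_bounded (μ := μ) h1 h1 h2 h2
    simpa [pow_two] using this
  have hI' : Integrable ((f - μ[f | coordSigma n E i]) ^ 2) μ := by
    have := hI.congr hsq
    exact this
  rw [integral_congr_ae hsq, ← setIntegral_univ (f := condVar (coordSigma n E i) f μ),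
    setIntegral_condVar (hm := hm) hI' MeasurableSet.univ, setIntegral_univ]

/-- **[K, bounded case]**: the Dobrushin–Glauber Poincaré inequality with conditional variances,
for bounded measurable `f` — PROVED. -/
theorem variance_le_sum_condVar_of_dobrushin_bounded
    (hloc : ∀ i (z : Fin (n + 1) → E) (y : E), K i (update z i y) = K i z)
    (hinv : ∀ i (F : (Fin (n + 1) → E) → ℝ≥0∞), Measurable F →
      ∫⁻ z, ∫⁻ y, F (update z i y) ∂(K i z) ∂μ = ∫⁻ z, F z ∂μ)
    {c : Fin (n + 1) → Fin (n + 1) → ℝ} (hc0 : ∀ i j, 0 ≤ c i j)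
    (hTV : ∀ i j (z : Fin (n + 1) → E) (y : E) (A : Set E), MeasurableSet A →
      ((K i z) A).toReal ≤ ((K i (update z j y)) A).toReal + c i j)
    {D : ℝ} (hrow : ∀ i, ∑ j, c i j ≤ D) (hD1 : D < 1)
    {f : (Fin (n + 1) → E) → ℝ} (hf : Measurable f) {M : ℝ} (hfM : ∀ z, |f z| ≤ M) :
    variance f μ ≤ (1 - D)⁻¹ * ∑ i, ∫ z, condVar (coordSigma n E i) f μ z ∂μ := by
  rw [variance_eq_integral hf.aemeasurable]
  have h := variance_le_of_dobrushin_bounded hloc hinv hc0 hTV hrow hD1 hf hfM (μ := μ)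
  simp_rw [integral_sq_sub_siteOp_eq_integral_condVar hloc hinv hf hfM] at h
  exact h

end Ident


/-! ### [I₂] The bounded-to-`L²` extension and the kernel `[I₂] → [K]` -/

/-- **[I₂] Bounded-to-`L²` extension (routine measure theory).** If, on a finite product
probability space, an inequality `Var_μ(g) ≤ C Σ_i ∫ Var_μ[g | z_{−i}] dμ` holds for every bounded
measurable `g`, then it holds for every `f ∈ L²(μ)`. (Truncate `f` at level `R`, use
`variance_eq_integral`, `condVar_ae_le_condExp_sq`, `condExp_add`, and let `R → ∞`; no Dobrushin
content.) This is the ONLY unproved piece of the addendum. -/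
def BoundedToL2Extension : Prop :=
  ∀ (n : ℕ) (E : Type) [MeasurableSpace E] (μ : Measure (Fin (n + 1) → E))
    [IsProbabilityMeasure μ] (C : ℝ), 0 ≤ C →
    (∀ g : (Fin (n + 1) → E) → ℝ, Measurable g → (∃ M : ℝ, ∀ z, |g z| ≤ M) →
      variance g μ ≤ C * ∑ i : Fin (n + 1), ∫ z, condVar
        (MeasurableSpace.comap (fun (z : Fin (n + 1) → E) (j : Fin n) => z (i.succAbove j))
          MeasurableSpace.pi) g μ z ∂μ) →
    ∀ f : (Fin (n + 1) → E) → ℝ, MemLp f 2 μ →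
      variance f μ ≤ C * ∑ i : Fin (n + 1), ∫ z, condVar
        (MeasurableSpace.comap (fun (z : Fin (n + 1) → E) (j : Fin n) => z (i.succAbove j))
          MeasurableSpace.pi) f μ z ∂μ

/-- KERNEL `[I₂] → [K]` (the statement of `[K]` expanded verbatim). -/
theorem dobrushinGlauberPoincare_of_extension (hI : BoundedToL2Extension) :
    ∀ (n : ℕ) (E : Type) [MeasurableSpace E]
    (μ : Measure (Fin (n + 1) → E)) [IsProbabilityMeasure μ]
    (K : Fin (n + 1) → Kernel (Fin (n + 1) → E) E) [∀ i, IsMarkovKernel (K i)]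
    (c : Fin (n + 1) → Fin (n + 1) → ℝ) (D : ℝ),
    (∀ i (z : Fin (n + 1) → E) (y : E), K i (Function.update z i y) = K i z) →
    (∀ i (f : (Fin (n + 1) → E) → ℝ≥0∞), Measurable f →
        ∫⁻ z, ∫⁻ y, f (Function.update z i y) ∂(K i z) ∂μ = ∫⁻ z, f z ∂μ) →
    (∀ i j, 0 ≤ c i j) →
    (∀ i j (z : Fin (n + 1) → E) (y : E) (A : Set E), MeasurableSet A →
        ((K i z) A).toReal ≤ ((K i (Function.update z j y)) A).toReal + c i j) →
    (∀ i, ∑ j, c i j ≤ D) → (∀ j, ∑ i, c i j ≤ D) → D < 1 →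
    ∀ f : (Fin (n + 1) → E) → ℝ, MemLp f 2 μ →
      variance f μ ≤ (1 - D)⁻¹ * ∑ i : Fin (n + 1), ∫ z, condVar
        (MeasurableSpace.comap (fun (z : Fin (n + 1) → E) (j : Fin n) => z (i.succAbove j))
          MeasurableSpace.pi) f μ z ∂μ := by
  intro n E _ μ _ K _ c D hloc hinv hc0 hTV hrow _hcol hD1 f hf
  have hC : 0 ≤ (1 - D)⁻¹ := inv_nonneg.2 (by linarith)
  refine hI n E μ (1 - D)⁻¹ hC (fun g hg hgM => ?_) f hf
  obtain ⟨M, hM⟩ := hgM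
  exact variance_le_sum_condVar_of_dobrushin_bounded hloc hinv hc0 hTV hrow hD1 hg hM

end Summit.AtomisticToContinuum.HydrodynamicLimit.Theorems.HardCorePoincareDobrushin.Abstract

end
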